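import Mathlib.NumberTheory.NumberField.AdeleRing
import Literature.NumberTheory.Automorphic.ArchimedeanCalculus
import Literature.NumberTheory.Automorphic.AutomorphicForms
import Literature.NumberTheory.Automorphic.AdelicGLnGlue
import Literature.NumberTheory.Automorphic.ArchimedeanGLn
import Literature.NumberTheory.Automorphic.AutomorphicRepsGL
import Literature.NumberTheory.Automorphic.GLnCuspidalSpectrum
import Literature.NumberTheory.Automorphic.AutomorphicSpectrum
import Literature.NumberTheory.Automorphic.AdelicGroupData
import HarnessLib

-- provenance: harness21/H21/H21/Statements/Lang/AutomorphicForms.lean @ e2147f8 (interim HEAD d8f2665); M5 mechanical rewrite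
/-!
# lang.S18: automorphic forms and automorphic representations of `GL_n(𝔸_K)` (Borel–Jacquet)

Family: Lang (statements; trunk AutomorphicL, item `LangAutomorphicForms`; notions
`automorphic_form`, `automorphic_representation`, `archimedean_gK_module`).

**lang.S18** (Borel–Jacquet, Corvallis 1979, §§4–5): *automorphic forms on `G(K)\G(𝔸_K)`
(smooth, `K_∞`-finite, `Z(𝔤)`-finite, of moderate growth); cusp forms; automorphic
representation = irreducible admissible `(𝔤_∞, K_∞) × G(𝔸_K^∞)`-subquotient; cuspidal
automorphic representation.* This is a *definition* item of the inventory; the definitions are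
the accepted preludes `AutomorphicForms` (general automorphy datum, BJ 4.2, 4.6),
`AdelicGLnGlue` (the honest datum `AutomorphyDatum.gl n K` of `GL_n` over a number field `K`) and
`AutomorphicRepsGL` (cusp forms, cuspidal representations of `GL_n`). This statement file

* unfolds them on the honest `GL_n` datum down to Mathlib objects, so that a reader can check
  faithfulness to BJ 4.2 without chasing the general datum: `Lang.isAutomorphicForm_gl_iff`
  (proved, definitional unfolding: left `GL_n(K)`-invariance through
  `Matrix.GeneralLinearGroup.map (algebraMap K 𝔸_K)`, right invariance under `{1} × U₀` for a
  compact open `U₀ ≤ GL_n(𝔸_K^∞)`, `ContDiff ℝ ∞` of `X ↦ φ (g · (exp X, 1))` on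
  `𝔤𝔩_n(K ⊗_ℚ ℝ)`, finite-dimensionality of the span of the right `K_∞`-translates,
  `Z(𝔤)`-finiteness, and `‖φ g‖ ≤ C (1 ⊔ ‖g‖)^r` for the adelic height `adelicHeightGL`),
  `Lang.isCuspFormGL_iff` (proved: the left unipotent integrals over `N_k(K)\N_k(𝔸_K)` vanish for
  `0 < k < n`), `Lang.automorphicRepData_irreducible` and
  `Lang.cuspidalAutomorphicRepData_le_cuspForms` (proved restatements of the datum
  `AutomorphicRepData` = irreducible stable subquotient `W / W'` of `𝒜`, BJ 4.6);
* states the theorems of BJ §4 that make the definitions meaningful, for `GL_n`, as **named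
  facts** (D-0014: `Prop`-valued definitions, known in print, proofs deferred):
  `Lang.harishChandra_finiteness` (BJ 4.3 (i) / Harish-Chandra 1968, Thm. 1),
  `Lang.automorphicRep_isAdmissible` (BJ 4.5), `Lang.cuspForm_bounded` (BJ 4.4 shape / 5.7:
  cusp forms with unitary central character are bounded, i.e. of moderate growth with exponent
  `0`);
* records the untagged bridges to G19's `L²` theory through the inversion dictionary
  `invQuot f g = f [g⁻¹]` (outline D2: G19's `automorphicQuotient = GL_n(𝔸_K) ⧸ A_G GL_n(K)` is a
  *left*-coset space, BJ forms are *left*-`G(K)`-invariant): `Lang.exists_isAssociatedL2`,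
  `Lang.exists_cuspidalRepData_of_L2` (under `[IsAutomorphicMeasure μ]`),
  `Lang.cuspConditionGL_invQuot_iff`; each takes the corresponding named fact of
  `AutomorphicRepsGL` (`Automorphic.exists_isAssociatedL2 hcpt μ`,
  `Automorphic.exists_cuspidalRepData_of_L2 hcpt μ`, `Automorphic.cuspConditionGL_invQuot_iff n K`)
  as a hypothesis `h` and specialises it.

## Design notes

* (M5 migration) The honest datum `AutomorphyDatum.gl n K hcpt` takes the named fact
  `hcpt : isCompact_glFiniteIntegralLevel n K` (`GLnAdelicStructure`) as an explicit parameter, so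
  every declaration mentioning it threads `hcpt` (explicit in the two `iff` unfoldings and the
  three named facts, implicit where it is read off the type of `π`).
* (H1) `attribute [local instance 100] LieRing.ofAssociativeRing`; (H3) the normed structure on
  `𝔤𝔩_n(mixedSpace K)` needed to *state* `ContDiff` is opened only by
  `open scoped Matrix.Norms.Operator in` on `Lang.isAutomorphicForm_gl_iff`; (H4)
  `ContDiff ℝ ∞` with `open scoped ContDiff`; (H5) `open scoped Classical`.
* Typing rule of `AutomorphicRepsGL`: forms and group elements live on
  `(AdelicGroupData.gl n K).Adelic` (definitionally `GL (Fin n) (AdeleRing (𝓞 K) K)`).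
* `Z(𝔤)`-finiteness is kept as the accepted `IsZFinite` (central words of `U(𝔤)` acting by
  iterated Lie derivatives, `ArchimedeanCalculus`); unfolding it further would only copy that
  file. In `Lang.harishChandra_finiteness` "annihilated by an ideal `J ≤ Z(𝔤)` of finite
  codimension" is literal (`J : Ideal (centerU _)`, `FiniteDimensional ℝ (Z(𝔤) ⧸ J)`, every
  central word mapping into `J` kills `φ`), and "finitely many `K_∞`-types" is expressed, as in
  the accepted `harishChandra_finiteness_gl`, by a finite-dimensional right-`K_∞`-stable space
  `M` of functions on `K_∞` containing all slices `k ↦ φ (g k)` (take `M` = matrix coefficients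
  of the finitely many types).
* `Lang.cuspForm_bounded`: "unitary central character" is the hypothesis `‖φ (z g)‖ = ‖φ g‖` for
  `z` in the centre of `GL_n(𝔸_K)` — exactly what BJ's argument uses, and it avoids choosing a
  parametrisation `𝔸_Kˣ ≅ Z(𝔸_K)`.
* Mathlib (grepped): `NumberField.AdeleRing`, `FiniteAdeleRing`, `mixedSpace`,
  `Matrix.GeneralLinearGroup.map`, `ContDiff`, `Submodule.span`, `Subgroup.center`,
  `Subgroup.subgroupOf`, `Ideal`, quotient modules. Mathlib has classical modular forms on `ℍ`
  (`NumberTheory/ModularForms`) but no adelic automorphic forms or automorphic representations.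

## References

* A. Borel, H. Jacquet, *Automorphic forms and automorphic representations*, Proc. Sympos. Pure
  Math. 33 (Corvallis 1979), part 1, 189–202, §4.2–4.6, §5.
* Harish-Chandra, *Automorphic forms on semisimple Lie groups*, LNM 62 (1968), Thm. 1.
* R. Godement, H. Jacquet, *Zeta functions of simple algebras*, LNM 260 (1972), §10.
-/

-- Mathlib idiom (Mathlib/Algebra/Lie/OfAssociative.lean); needed to mention Lie subalgebras of matrix algebras
attribute [local instance 100] LieRing.ofAssociativeRing

open scoped MatrixGroups Matrix ContDiff Classical
open NumberField NumberField.mixedEmbedding IsDedekindDomain MeasureTheory Literature.NumberTheory.Automorphic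

noncomputable section

namespace Literature.NumberTheory.Automorphic

variable (n : ℕ) (K : Type) [Field K] [NumberField K] (hcpt : isCompact_glFiniteIntegralLevel n K)

/-! ## Automorphic forms on `GL_n(𝔸_K)` unfolded (BJ 4.2) -/

open scoped Matrix.Norms.Operator in
/-- **lang.S18** (automorphic forms; Borel–Jacquet 1979, 4.2, for `G = GL_n` over the number
field `K`). A function `φ : GL_n(𝔸_K) → ℂ` is an automorphic form iff
(a) `φ (γ g) = φ g` for `γ ∈ GL_n(K)` (embedded diagonally) and `φ (g u) = φ g` for `u` in a
compact open subgroup `U₀ ≤ GL_n(𝔸_K^∞)` (embedded as `(1, u)`);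
(b) `X ↦ φ (g (exp X, 1))` is `C^∞` on `𝔤 = 𝔤𝔩_n(K ⊗_ℚ ℝ) = M_n(ℝ^{r₁} × ℂ^{r₂})` for every `g`,
and the right translates `g ↦ φ (g (k, 1))`, `k ∈ K_∞ = ∏ O(n) × ∏ U(n)`, span a
finite-dimensional space;
(c) `φ` is `Z(𝔤)`-finite;
(d) `‖φ g‖ ≤ C (1 ⊔ ‖g‖)^r` for the adelic height `‖g‖ = ∏_v max_{ij} (|g_{ij}|_v ⊔ |g^{ij}|_v)`.
Proved by unfolding the accepted `IsAutomorphicForm (AutomorphyDatum.gl n K hcpt)`. [cite: BorelJacquet1979, 4.2] -/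
theorem isAutomorphicForm_gl_iff (φ : GL (Fin n) (AdeleRing (𝓞 K) K) → ℂ) :
    IsAutomorphicForm (AutomorphyDatum.gl n K hcpt) φ ↔
      (∀ (γ : GL (Fin n) K) (g : GL (Fin n) (AdeleRing (𝓞 K) K)),
          φ (Matrix.GeneralLinearGroup.map (algebraMap K (AdeleRing (𝓞 K) K)) γ * g) = φ g) ∧
      (∃ U₀ : Subgroup (GL (Fin n) (FiniteAdeleRing (𝓞 K) K)),
          IsOpen (U₀ : Set (GL (Fin n) (FiniteAdeleRing (𝓞 K) K))) ∧
          IsCompact (U₀ : Set (GL (Fin n) (FiniteAdeleRing (𝓞 K) K))) ∧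
            ∀ u ∈ U₀, ∀ g : GL (Fin n) (AdeleRing (𝓞 K) K), φ (g * GLn.ofFinite n K u) = φ g) ∧
      (∀ g : GL (Fin n) (AdeleRing (𝓞 K) K), ContDiff ℝ ∞
          fun X : (⊤ : LieSubalgebra ℝ (Matrix (Fin n) (Fin n) (mixedSpace K))).toSubmodule ↦
            φ (g * GLn.ofInfinite n K (expGL (X : Matrix (Fin n) (Fin n) (mixedSpace K))))) ∧
      FiniteDimensional ℂ (Submodule.span ℂ (Set.range fun k : Kinf n K ↦
          fun g : GL (Fin n) (AdeleRing (𝓞 K) K) ↦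
            φ (g * GLn.ofInfinite n K (k : GL (Fin n) (mixedSpace K))))) ∧
      IsZFinite (AutomorphyDatum.gl n K hcpt).ofArch φ ∧
      ∃ (C : ℝ) (r : ℕ), ∀ g : GL (Fin n) (AdeleRing (𝓞 K) K),
          ‖φ g‖ ≤ C * (1 ⊔ adelicHeightGL n K g) ^ r := by
  constructor
  · rintro ⟨ha, ⟨U, hU, hUφ⟩, hb, hk, hc, hd⟩
    refine ⟨fun γ g ↦ ha _ ⟨γ, rfl⟩ g, ?_, hb, hk, hc, hd⟩
    obtain ⟨U₀, hopen, hcpt, rfl⟩ := hU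
    exact ⟨U₀, hopen, hcpt, fun u hu g ↦ hUφ _ (Subgroup.mem_map_of_mem _ hu) g⟩
  · rintro ⟨ha, ⟨U₀, hopen, hcpt, hUφ⟩, hb, hk, hc, hd⟩
    refine ⟨?_, ?_, hb, hk, hc, hd⟩
    · rintro _ ⟨γ, rfl⟩ g
      exact ha γ g
    · refine ⟨U₀.map (GLn.ofFinite n K), ⟨U₀, hopen, hcpt, rfl⟩, ?_⟩
      rintro _ ⟨u, hu, rfl⟩ g
      exact hUφ u hu g

/-! ## Cusp forms unfolded (BJ 4.4) -/

/-- **lang.S18** (cusp forms; Borel–Jacquet 1979, 4.4; Godement–Jacquet, LNM 260, §10).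
`φ : GL_n(𝔸_K) → ℂ` is a cusp form iff it is an automorphic form and, for every standard maximal
parabolic `P_k = M_k N_k` (`0 < k < n`), the constant term
`g ↦ ∫_{N_k(K)\N_k(𝔸_K)} φ (u g) du` vanishes identically: for every additive Haar measure `ν`
on `𝔫_k(𝔸_K)` and every measurable fundamental domain `𝓕` of `𝔫_k(K)`, the function
`X ↦ φ ((1 + X) g)` is integrable on `𝓕` with integral `0` (unipotent variable on the *left*,
as `φ` is left `GL_n(K)`-invariant). Definitional unfolding of the accepted `IsCuspFormGL`. [cite: BorelJacquet1979, 4.4] -/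
theorem isCuspFormGL_iff (φ : (AdelicGroupData.gl n K).Adelic → ℂ) :
    IsCuspFormGL n K hcpt φ ↔
      IsAutomorphicForm (AutomorphyDatum.gl n K hcpt) φ ∧
        ∀ k, 0 < k → k < n →
          ∀ (ν : Measure (blockNilpotent n k (AdeleRing (𝓞 K) K))) [ν.IsAddHaarMeasure]
            (𝓕 : Set (blockNilpotent n k (AdeleRing (𝓞 K) K))),
            IsAddFundamentalDomain (rationalBlock n k K) 𝓕 ν →
              ∀ g : (AdelicGroupData.gl n K).Adelic,
                IntegrableOn (fun X ↦ φ (glUnipotent n k K (Multiplicative.ofAdd X) * g)) 𝓕 ν ∧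
                  ∫ X in 𝓕, φ (glUnipotent n k K (Multiplicative.ofAdd X) * g) ∂ν = 0 :=
  Iff.rfl

/-! ## Automorphic representations (BJ 4.6) -/

variable {n K hcpt}

/-- **lang.S18** (automorphic representation = irreducible `(𝔤, K_∞) × G(𝔸_f)`-subquotient of
the space of automorphic forms; Borel–Jacquet 1979, 4.6). An automorphic representation datum
`π` of `GL_n(𝔸_K)` consists of two `(𝔤, K_∞) × GL_n(𝔸_K^∞)`-stable subspaces `W' < W` of the
space `𝒜` of automorphic forms (stable under right translation by `GL_n(𝔸_K^∞)` and `K_∞` and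
under the Lie derivatives `X φ`, `X ∈ 𝔤`) such that `W / W'` is irreducible: every stable `W''`
with `W' ≤ W'' ≤ W` is `W'` or `W`. (Restatement of the fields of the accepted
`AutomorphicRepData`; admissibility of `W / W'` is the theorem `Lang.automorphicRep_isAdmissible`,
BJ 4.5.) [cite: BorelJacquet1979, 4.6] -/
theorem automorphicRepData_irreducible (π : AutomorphicRepData (AutomorphyDatum.gl n K hcpt)) :
    π.W' < π.W ∧ IsStableSubmodule (AutomorphyDatum.gl n K hcpt) π.W ∧
      IsStableSubmodule (AutomorphyDatum.gl n K hcpt) π.W' ∧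
        ∀ W'' : Submodule ℂ ((AdelicGroupData.gl n K).Adelic → ℂ), π.W' ≤ W'' → W'' ≤ π.W →
          IsStableSubmodule (AutomorphyDatum.gl n K hcpt) W'' → W'' = π.W' ∨ W'' = π.W :=
  ⟨π.lt, π.stable, π.stable', π.irreducible⟩

/-- **lang.S18** (cuspidal automorphic representation; Borel–Jacquet 1979, 4.6). A cuspidal
automorphic representation datum `π = W / W'` of `GL_n(𝔸_K)` is an automorphic representation
datum realised on cusp forms: `W ≤ 𝒜₀ = cuspFormsGL n K hcpt` (so every `φ ∈ W` has vanishing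
constant terms along all proper standard parabolics, `cuspConditionGL_of_mem_cuspFormsGL`).
Restatement of the accepted `CuspidalAutomorphicRepData`. [cite: BorelJacquet1979, 4.6] -/
theorem cuspidalAutomorphicRepData_le_cuspForms (π : CuspidalAutomorphicRepData n K hcpt) :
    π.1.W ≤ cuspFormsGL n K hcpt ∧
      ∀ φ ∈ π.1.W, ∀ k, 0 < k → k < n → CuspConditionGL n K φ k :=
  ⟨π.2, fun _ hφ _ hk hkn ↦ cuspConditionGL_of_mem_cuspFormsGL (π.2 hφ) hk hkn⟩

/-! ## The theorems of Borel–Jacquet §4 for `GL_n` (named facts, D-0014) -/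

variable (hcpt) in
/-- **Harish-Chandra's finiteness theorem** (Borel–Jacquet 1979, 4.3 (i); Harish-Chandra,
LNM 62 (1968), Thm. 1), for `GL_n` over `K`: the automorphic forms of a fixed level
`U ∈ finiteLevelsGL n K`, annihilated by a fixed ideal `J` of finite codimension of `Z(𝔤)` (every
central word whose image in `Z(𝔤)` lies in `J` kills `φ`), and with `K_∞`-types in a fixed finite
set — expressed by a finite-dimensional right-`K_∞`-stable space `M` of functions on `K_∞`
containing every slice `k ↦ φ (g k)` — span a finite-dimensional complex vector space; for
every such `U`, `J`, `M`. Named fact (D-0014). [cite: BorelJacquet1979, 4.3 (i)] -/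
def harishChandra_finiteness : Prop :=
  ∀ {U : Subgroup (GL (Fin n) (AdeleRing (𝓞 K) K))}, U ∈ finiteLevelsGL n K →
    ∀ (J : Ideal (centerU (archGroupGL n K))) [FiniteDimensional ℝ (centerU (archGroupGL n K) ⧸ J)]
      (M : Submodule ℂ (Kinf n K → ℂ)) [FiniteDimensional ℂ M],
      (∀ k₀ : Kinf n K, ∀ f ∈ M, (fun k ↦ f (k * k₀)) ∈ M) →
        FiniteDimensional ℂ (Submodule.span ℂ
          {φ : (AdelicGroupData.gl n K).Adelic → ℂ |
            IsAutomorphicForm (AutomorphyDatum.gl n K hcpt) φ ∧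
            IsRightInvariantUnder U φ ∧
            (∀ (p : FreeAlgebra ℝ (archGroupGL n K).lie) (hp : IsCentralWord p),
              (⟨freeToEnveloping (archGroupGL n K) p, hp⟩ : centerU (archGroupGL n K)) ∈ J →
                applyFree (AutomorphyDatum.gl n K hcpt).ofArch p φ = 0) ∧
            ∀ g : (AdelicGroupData.gl n K).Adelic,
              (fun k : Kinf n K ↦ φ (g * (AutomorphyDatum.gl n K hcpt).ofK k)) ∈ M})

variable (hcpt) in
/-- **Automorphic representations are admissible** (Borel–Jacquet 1979, 4.5 with 4.3 (i) and
4.6; Harish-Chandra, LNM 62, Thm. 1), for `GL_n` over `K`: for an automorphic representation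
datum `π = W / W'` the action of `GL_n(𝔸_K^∞)` on `W / W'` by right translation is smooth, and
for every level `U` (a compact open subgroup of `GL_n(𝔸_K^∞)`) the `K_∞`-module `(W / W')^U` is
admissible: every irreducible finite-dimensional representation of `K_∞` occurs in it with finite
multiplicity. Equivalently `W / W' ≅ π_∞ ⊗ π_f` with `π_∞` an admissible `(𝔤, K_∞)`-module and
`π_f` an admissible representation of `GL_n(𝔸_K^∞)`. For every datum `π`. Named fact
(D-0014). [cite: BorelJacquet1979, 4.5] -/
def automorphicRep_isAdmissible : Prop :=
  ∀ π : AutomorphicRepData (AutomorphyDatum.gl n K hcpt),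
    π.finiteRep.IsSmooth ∧
      ∀ U ∈ finiteLevelsGL n K,
        IsAdmissibleGK (π.kRepFixed (U.subgroupOf (AutomorphyDatum.gl n K hcpt).finiteAdelic))

variable (hcpt) in
/-- **Cusp forms are bounded** (Borel–Jacquet 1979, 4.4 and 5.7 shape; Godement–Jacquet, LNM 260,
§10; Gelfand–Graev–Piatetski-Shapiro 1969, Ch. 3): a cusp form `φ` on `GL_n(𝔸_K)` whose absolute
value is invariant under the centre `Z(𝔸_K) ≅ 𝔸_Kˣ` of `GL_n(𝔸_K)` (e.g. `φ` has a unitary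
central character) is bounded, i.e. has moderate growth with exponent `r = 0`
(rapid decay on Siegel sets modulo the centre); for every such `φ`. Named fact (D-0014). [cite: BorelJacquet1979, 4.4 and 5.7] -/
def cuspForm_bounded : Prop :=
  ∀ {φ : (AdelicGroupData.gl n K).Adelic → ℂ}, IsCuspFormGL n K hcpt φ →
    (∀ z ∈ Subgroup.center (AdelicGroupData.gl n K).Adelic, ∀ g, ‖φ (z * g)‖ = ‖φ g‖) →
      ∃ C : ℝ, ∀ g : (AdelicGroupData.gl n K).Adelic, ‖φ g‖ ≤ C

/-! ## Bridges to G19's `L²` theory through the inversion dictionary (D2) -/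

/-- The inversion bridge for cuspidality (outline D2; Borel–Jacquet 1979, 4.4): for a function
`f` on G19's left-coset space `GL_n(𝔸_K) ⧸ A_G GL_n(K)`, the left-`A_G GL_n(K)`-invariant
function `g ↦ f [g⁻¹]` (`invQuot`) satisfies the Borel–Jacquet cusp condition along `P_k`
(unipotent integral on the left) iff `f` has vanishing `k`-th constant term in G19's sense
`ConstantTermVanishes` (unipotent integral on the right). Specialisation, with `invQuot`
unfolded, of the accepted named fact `Automorphic.cuspConditionGL_invQuot_iff n K`
(hypothesis `h`). [cite: BorelJacquet1979, 4.4] -/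
theorem LangAutomorphicForms.cuspConditionGL_invQuot_iff (h : AutomorphicRepsGL.cuspConditionGL_invQuot_iff n K)
    (f : (AdelicGroupData.gl n K).automorphicQuotient → ℂ) (k : ℕ) :
    CuspConditionGL n K (fun g ↦ f ((AdelicGroupData.gl n K).toAutomorphicQuotient g⁻¹)) k ↔
      ConstantTermVanishes n K f k :=
  h f k

section L2

variable {μ : Measure (AdelicGroupData.gl n K).automorphicQuotient}
  [(AdelicGroupData.gl n K).IsAutomorphicMeasure μ]

variable (μ) in
/-- From `(𝔤, K_∞) × GL_n(𝔸_K^∞)`-modules to `L²` (outline D2 (ii); Borel–Jacquet 1979, 4.4–4.6;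
Gelfand–Graev–Piatetski-Shapiro 1969, Ch. 3): a cuspidal automorphic representation datum
`π = W / W'` of `GL_n(𝔸_K)` whose forms are invariant under `A_G = ℝ_{>0}` (positive real
scalars at infinity, `(AdelicGroupData.gl n K).center'`) is associated (`IsAssociatedL2`:
`W = W' + V_Π`, `V_Π` spanned by the automorphic forms `g ↦ f [g⁻¹]`, `[f] ∈ Π`) with an
irreducible closed subspace `Π` of `L²_cusp(GL_n(𝔸_K) ⧸ A_G GL_n(K), μ)` for the automorphic
measure `μ` (a G19 `CuspidalAutomorphicRepGL`). Specialisation of the accepted named fact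
`Automorphic.exists_isAssociatedL2 hcpt μ` (hypothesis `h`). [cite: BorelJacquet1979, 4.4–4.6] -/
theorem LangAutomorphicForms.exists_isAssociatedL2 (h : AutomorphicRepsGL.exists_isAssociatedL2 hcpt μ)
    (π : CuspidalAutomorphicRepData n K hcpt)
    (hπ : ∀ φ ∈ π.1.W, ∀ z ∈ (AdelicGroupData.gl n K).center', ∀ g, φ (z * g) = φ g) :
    ∃ P : CuspidalAutomorphicRepGL n K μ, IsAssociatedL2 π P :=
  h π hπ

/-- From `L²` to `(𝔤, K_∞) × GL_n(𝔸_K^∞)`-modules (outline D2 (ii); Borel–Jacquet 1979, 4.6;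
Harish-Chandra 1953): every irreducible closed invariant subspace `Π` of
`L²_cusp(GL_n(𝔸_K) ⧸ A_G GL_n(K), μ)` comes from a cuspidal automorphic representation datum
`π = W / ⊥` with `W = V_Π` the span of the automorphic forms `g ↦ f [g⁻¹]`, `[f] ∈ Π` (the smooth
`K_∞`-finite vectors of `Π`). Specialisation of the accepted named fact
`Automorphic.exists_cuspidalRepData_of_L2 hcpt μ` (hypothesis `h`). [cite: BorelJacquet1979, 4.6] -/
theorem LangAutomorphicForms.exists_cuspidalRepData_of_L2 (h : AutomorphicRepsGL.exists_cuspidalRepData_of_L2 hcpt μ)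
    (P : CuspidalAutomorphicRepGL n K μ) :
    ∃ π : CuspidalAutomorphicRepData n K hcpt, π.1.W' = ⊥ ∧ IsAssociatedL2 π P :=
  h P

end L2

end Literature.NumberTheory.Automorphic
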